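import Literature.AlgebraicGeometry.Frobenioids.UnitTrivializationBirat
import Literature.AlgebraicGeometry.Frobenioids.BirationalizationIstrComparison
import Literature.AlgebraicGeometry.Frobenioids.BirationalizationBiratData
import Literature.AlgebraicGeometry.Frobenioids.BiratLocalization
import Mathlib.CategoryTheory.Endomorphism
import HarnessLib

/-!
# Frobenioids I, Prop. 5.5 (iii) input: a Frobenius-compact object of `C^birat` yields one of
# `(C^un-tr)^birat` when `C` is of isotropic and unit-trivial type

Mochizuki, *The geometry of Frobenioids I: the general theory*, Kyushu J. Math. **62** (2008)
293–400, Def. 1.2 (iv) p. 23 (Frobenius-compact objects: a condition on `Aut_C(A)` and `O^×(A)` only),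
Def. 4.5 (iii)(b) p. 86 ("`(C^un-tr)^birat` admits a Frobenius-compact object"), Prop. 4.4 (i) p. 82,
Prop. 5.5 (iii) p. 104 ll. 37–39 (rationally standard type passes to `C^un-tr`; proof p. 105 ll. 20–27
"it follows immediately from the definitions"). [cite: MochizukiFrdI2008, Prop. 5.5 (iii) p.104]

PROOF-ONLY companion (cell abc-iut, sub-DAG S7 row `FrdI:Prop5.5(iii)/P55-L07` ratStd half, seat
abc-iut-w5-d250). For the un-tr conjunct of "rationally standard", Def. 4.5 (iii)(b) for `C^un-tr`
asks for a Frobenius-compact object of `((C^un-tr)^un-tr)^birat`, while the hypothesis for `C` provides one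
of `(C^un-tr)^birat`. Since `C^un-tr` is of isotropic and unit-trivial type, this file moves
Frobenius-compactness UP along the two comparison functors of the tree, for any Frobenioid `F : C → F_Φ`:
* `PreFrobenioidData.isFrobeniusCompact_transfer` — Frobenius-compactness only involves `Aut(A)` and
  `O^×(A)` (Def. 1.2 (iv)), so it moves along any group isomorphism `Aut(A₁) ≅ Aut(A₂)` matching the
  unit subgroups;
* `Birat.isFrobeniusCompact_istrBirat_of_ofIstr` — from `A^birat ∈ C^birat` back to
  `(A^istr)^birat ∈ (C^istr)^birat` along the fully faithful comparison functor `Birat.ofIstr`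
  (`BirationalizationIstrComparison`, seat abc-iut-L1-d5; bases and degrees preserved);
* `Birat.toUntrBirat_faithful` — for `C` of UNIT-TRIVIAL type the comparison functor
  `toUntrBirat : (C^istr)^birat → (C^un-tr)^birat` (`UnitTrivializationBirat`, seat abc-iut-L1-d5; full
  in general) is also faithful: a colimit relation between two image fractions in `C^un-tr` lifts to
  `C^istr` because `C^istr → C^un-tr` is then injective on arrows (Prop. 3.3 (iii));
* `Birat.isFrobeniusCompact_toUntrBirat_obj` — hence Frobenius-compactness moves from
  `(A^istr)^birat` to `(A^un-tr)^birat`;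
* **`Birat.exists_isFrobeniusCompact_untrBirat_of`** — for `C` of isotropic and unit-trivial type, a
  Frobenius-compact object of `C^birat` yields one of `(C^un-tr)^birat` (apply to `C := C₀^un-tr`).
No statement of the paper is strengthened; nothing here bears on [IUTchIII] Cor. 3.12.
-/

namespace Literature.AlgebraicGeometry.Frobenioids

open CategoryTheory Opposite

/-! ### Frobenius-compactness moves along isomorphisms of automorphism groups matching the units -/

namespace PreFrobenioidData

universe w₁ v₁ v₁' u₁ u₁' w₂ v₂ v₂' u₂ u₂'

variable {C₁ : Type u₁} [Category.{v₁} C₁] {D₁ : Type u₁'} [Category.{v₁'} D₁]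
  {C₂ : Type u₂} [Category.{v₂} C₂] {D₂ : Type u₂'} [Category.{v₂'} D₂]

/-- **Def. 1.2 (iv) only sees `Aut(A)` and `O^×(A)`**: if `e : Aut(A₁) ≅ Aut(A₂)` is a group isomorphism
carrying `O^×(A₁)` onto `O^×(A₂)`, then `A₁` Frobenius-compact implies `A₂` Frobenius-compact (the three
clauses — `O^×` commutative, a non-torsion unit, the `λ`-action clause — are transported through `e`).
[cite: MochizukiFrdI2008, Def. 1.2 (iv) p.23] -/
theorem isFrobeniusCompact_transfer (S₁ : PreFrobenioidData.{w₁} C₁ D₁) (S₂ : PreFrobenioidData.{w₂} C₂ D₂)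
    {X₁ : C₁} {X₂ : C₂} (e : Aut X₁ ≃* Aut X₂)
    (hU : ∀ u : Aut X₁, u ∈ S₁.unitsSubgroup X₁ ↔ e u ∈ S₂.unitsSubgroup X₂)
    (h : S₁.IsFrobeniusCompact X₁) : S₂.IsFrobeniusCompact X₂ := by
  obtain ⟨hcomm, ⟨u₀, hu₀, hnt⟩, hlam⟩ := h
  have hU' : ∀ w : Aut X₂, w ∈ S₂.unitsSubgroup X₂ ↔ e.symm w ∈ S₁.unitsSubgroup X₁ := fun w => by
    rw [hU, MulEquiv.apply_symm_apply]
  refine ⟨?_, ?_, ?_⟩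
  · intro w hw w' hw'
    have hc := hcomm (e.symm w) ((hU' w).mp hw) (e.symm w') ((hU' w').mp hw')
    have hc' := congrArg e hc
    rwa [map_mul, map_mul, MulEquiv.apply_symm_apply, MulEquiv.apply_symm_apply] at hc'
  · refine ⟨e u₀, (hU u₀).mp hu₀, fun N hN hN1 => hnt N hN (e.injective ?_)⟩
    rw [map_pow, hN1, map_one]
  · intro f p q hyp w hw
    have hyp' : ∀ u ∈ S₁.unitsSubgroup X₁,
        ∃ N : ℕ, 0 < N ∧ ((e.symm f * u * (e.symm f)⁻¹) ^ (q : ℕ)) ^ N = (u ^ (p : ℕ)) ^ N := by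
      intro u hu
      obtain ⟨N, hN, hEq⟩ := hyp (e u) ((hU u).mp hu)
      refine ⟨N, hN, e.injective ?_⟩
      rw [map_pow, map_pow, map_pow, map_pow, map_mul, map_mul, map_inv, MulEquiv.apply_symm_apply]
      exact hEq
    obtain ⟨N, hN, hEq⟩ := hlam (e.symm f) p q hyp' (e.symm w) ((hU' w).mp hw)
    refine ⟨N, hN, ?_⟩
    have h' := congrArg e hEq
    rwa [map_pow, map_pow, map_mul, map_mul, map_inv, MulEquiv.apply_symm_apply,
      MulEquiv.apply_symm_apply] at h'

end PreFrobenioidData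

namespace PreFrobenioid

universe w v v' u u'

variable {D : Type u} [Category.{v} D] {Φ : Dᵒᵖ ⥤ CommMonCat.{w}}
  {C : Type u'} [Category.{v'} C] {F : C ⥤ ElemFrobenioid Φ}

open PreFrobenioidData (ofFunctor)

namespace Birat

/-! ### Down the fully faithful `(C^istr)^birat → C^birat` -/

/-- **Frobenius-compactness of `A^birat` in `C^birat` (for `A` isotropic) gives Frobenius-compactness of
`(A^istr)^birat` in `(C^istr)^birat`**: the comparison functor `Birat.ofIstr` is fully faithful and
preserves bases and Frobenius degrees, so it identifies `Aut` and `O^×` of the two objects.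
[cite: MochizukiFrdI2008, Prop. 4.4 (i) p.82] -/
theorem isFrobeniusCompact_istrBirat_of_ofIstr (hF : IsFrobenioid F) (hsq : HasBiratSquares F)
    (hsq' : HasBiratSquares (istrFunctor F)) (X : Birat (istrFunctor F) (isFrobenioid_istr hF) hsq')
    (h : (ofFunctor (zeroMonoid D) (toElemZero hF hsq)).IsFrobeniusCompact ((ofIstr hF hsq hsq').obj X)) :
    (ofFunctor (zeroMonoid D) (toElemZero (isFrobenioid_istr hF) hsq')).IsFrobeniusCompact X := by
  haveI := ofIstr_full (hF := hF) (hsq := hsq) (hsq' := hsq')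
  haveI := ofIstr_faithful (hF := hF) (hsq := hsq) (hsq' := hsq')
  let e : Aut X ≃* Aut ((ofIstr hF hsq hsq').obj X) :=
    (Functor.FullyFaithful.ofFullyFaithful (ofIstr hF hsq hsq')).autMulEquivOfFullyFaithful X
  refine PreFrobenioidData.isFrobeniusCompact_transfer _ _ e.symm (fun w => ?_) h
  obtain ⟨u, rfl⟩ := e.surjective w
  rw [MulEquiv.symm_apply_apply]
  change IsBaseIdentity (toElemZero hF hsq) ((ofIstr hF hsq hsq').map u.hom) ∧
      IsLinear (toElemZero hF hsq) ((ofIstr hF hsq hsq').map u.hom) ↔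
    IsBaseIdentity (toElemZero (isFrobenioid_istr hF) hsq') u.hom ∧
      IsLinear (toElemZero (isFrobenioid_istr hF) hsq') u.hom
  unfold IsBaseIdentity IsLinear
  rw [base_ofIstr_map, degFr_ofIstr_map]
  rfl

/-! ### Up the comparison `(C^istr)^birat → (C^un-tr)^birat` for `C` of unit-trivial type -/

/-- **For `C` of unit-trivial type, `(C^istr)^birat → (C^un-tr)^birat` is faithful**: if the image
fractions `([α₁], [φ₁′])`, `([α₂], [φ₂′])` are related in the colimit defining `Hom^birat` of `C^un-tr`
(equal after refinement by co-angular pre-steps `[ε], [ε′]`), then so are `(α₁, φ₁′)`, `(α₂, φ₂′)` in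
`C^istr`: `C^istr → C^un-tr` is injective on arrows (Prop. 3.3 (iii), unit-trivial type) and a pre-step
of `C` out of an isotropic object is a co-angular pre-step of `C^istr`.
[cite: MochizukiFrdI2008, Prop. 3.3 (iii) p.59] -/
theorem toUntrBirat_faithful (hF : IsFrobenioid F) (hsq' : HasBiratSquares (istrFunctor F))
    (hut : IsOfType (IsUnitTrivial F)) : (toUntrBirat hF hsq').Faithful := by
  have hut' : ∀ A : C, (ofFunctor Φ F).IsIsotropic A → (ofFunctor Φ F).IsUnitTrivial A :=
    fun A _ => (PreFrobenioidData.ofFunctor_isUnitTrivial F A).mpr (hut A)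
  refine ⟨fun {X Y} g₁ g₂ hg => ?_⟩
  obtain ⟨f₁, rfl⟩ := homMk_surjective g₁
  obtain ⟨f₂, rfl⟩ := homMk_surjective g₂
  rw [toUntrBirat_map_homMk, toUntrBirat_map_homMk] at hg
  obtain ⟨E, ε, ε', hε, hε', hden, hnum⟩ := homMk_eq_homMk_iff.mp hg
  obtain ⟨e, rfl⟩ := (ofFunctor Φ F).toUntr.map_surjective (X := E.as)
    (Y := (istrToData F).obj f₁.src) ε
  obtain ⟨e', rfl⟩ := (ofFunctor Φ F).toUntr.map_surjective (X := E.as)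
    (Y := (istrToData F).obj f₂.src) ε'
  have hE : IsIsotropic F E.as.obj := (PreFrobenioidData.ofFunctor_isIsotropic F E.as.obj).mp E.as.property
  -- the two equations descend to `C^istr`
  have hden' : e ≫ (istrToData F).map f₁.den = e' ≫ (istrToData F).map f₂.den :=
    PreFrobenioidData.toUntr_map_injective_of_isUnitTrivial_istr (ofFunctor Φ F) hut' (by
      rw [Functor.map_comp, Functor.map_comp]; exact hden)
  have hnum' : e ≫ (istrToData F).map f₁.num = e' ≫ (istrToData F).map f₂.num :=
    PreFrobenioidData.toUntr_map_injective_of_isUnitTrivial_istr (ofFunctor Φ F) hut' (by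
      rw [Functor.map_comp, Functor.map_comp]; exact hnum)
  apply homMk_sound
  refine ⟨Istr.mk E.as.obj hE, (ObjectProperty.homMk e.hom : Istr.mk E.as.obj hE ⟶ f₁.src),
    (ObjectProperty.homMk e'.hom : Istr.mk E.as.obj hE ⟶ f₂.src), ?_, ?_, ?_, ?_⟩
  · exact (isCoAngularPreStep_istr_iff hF _).mpr
      ⟨isCoAngular_of_isIsotropic_src hF e.hom hE, (isPreStep_toUntr_iff e).mp hε.2⟩
  · exact (isCoAngularPreStep_istr_iff hF _).mpr
      ⟨isCoAngular_of_isIsotropic_src hF e'.hom hE, (isPreStep_toUntr_iff e').mp hε'.2⟩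
  · apply ObjectProperty.hom_ext
    change e.hom ≫ f₁.den.hom = e'.hom ≫ f₂.den.hom
    exact congrArg InducedCategory.Hom.hom hden'
  · apply ObjectProperty.hom_ext
    change e.hom ≫ f₁.num.hom = e'.hom ≫ f₂.num.hom
    exact congrArg InducedCategory.Hom.hom hnum'

/-- **Frobenius-compactness of `(A^istr)^birat` gives Frobenius-compactness of `(A^un-tr)^birat`** for `C`
of unit-trivial type: `toUntrBirat` is then fully faithful and preserves bases and Frobenius degrees.
[cite: MochizukiFrdI2008, Def. 4.5 (iii) p.86] -/
theorem isFrobeniusCompact_toUntrBirat_obj (hF : IsFrobenioid F) (hsq' : HasBiratSquares (istrFunctor F))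
    (hut : IsOfType (IsUnitTrivial F)) (X : Birat (istrFunctor F) (isFrobenioid_istr hF) hsq')
    (h : (ofFunctor (zeroMonoid D) (toElemZero (isFrobenioid_istr hF) hsq')).IsFrobeniusCompact X) :
    (ofFunctor (zeroMonoid D) (toElemZero (isFrobenioid_untr hF) (hasBiratSquares_untr hF))).IsFrobeniusCompact
      ((toUntrBirat hF hsq').obj X) := by
  haveI := toUntrBirat_full (hF := hF) (hsq' := hsq')
  haveI := toUntrBirat_faithful hF hsq' hut
  let e : Aut X ≃* Aut ((toUntrBirat hF hsq').obj X) :=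
    (Functor.FullyFaithful.ofFullyFaithful (toUntrBirat hF hsq')).autMulEquivOfFullyFaithful X
  refine PreFrobenioidData.isFrobeniusCompact_transfer _ _ e (fun u => ?_) h
  change IsBaseIdentity (toElemZero (isFrobenioid_istr hF) hsq') u.hom ∧
      IsLinear (toElemZero (isFrobenioid_istr hF) hsq') u.hom ↔
    IsBaseIdentity (toElemZero (isFrobenioid_untr hF) (hasBiratSquares_untr hF))
        ((toUntrBirat hF hsq').map u.hom) ∧
      IsLinear (toElemZero (isFrobenioid_untr hF) (hasBiratSquares_untr hF)) ((toUntrBirat hF hsq').map u.hom)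
  unfold IsBaseIdentity IsLinear
  rw [base_toUntrBirat_map, degFr_toUntrBirat_map]
  rfl

/-! ### Assembly: `C^birat ⇒ (C^un-tr)^birat` for `C` of isotropic and unit-trivial type -/

/-- **A Frobenius-compact object of `C^birat` yields one of `(C^un-tr)^birat`** when `C` is of isotropic and
unit-trivial type: `A^birat` is the image of `(A^istr)^birat` under `ofIstr` (`A` is isotropic), which is
Frobenius-compact (`isFrobeniusCompact_istrBirat_of_ofIstr`), whence so is its image `(A^un-tr)^birat`
(`isFrobeniusCompact_toUntrBirat_obj`). Applied to `C := C₀^un-tr` this is the passage from Def. 4.5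
(iii)(b) for `C₀` to Def. 4.5 (iii)(b) for `C₀^un-tr` in Prop. 5.5 (iii).
[cite: MochizukiFrdI2008, Prop. 5.5 (iii) p.104] -/
theorem exists_isFrobeniusCompact_untrBirat_of (hF : IsFrobenioid F) (hsq : HasBiratSquares F)
    (hiso : IsOfIsotropicType F) (hut : IsOfType (IsUnitTrivial F))
    (h : ∃ X : Birat F hF hsq, (ofFunctor (zeroMonoid D) (toElemZero hF hsq)).IsFrobeniusCompact X) :
    ∃ Y : Birat (untrFunctor hF) (isFrobenioid_untr hF) (hasBiratSquares_untr hF),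
      (ofFunctor (zeroMonoid D) (toElemZero (isFrobenioid_untr hF) (hasBiratSquares_untr hF))).IsFrobeniusCompact Y := by
  obtain ⟨X, hX⟩ := h
  have hsq' : HasBiratSquares (istrFunctor F) := hasBiratSquares_of_isFrobenioid (isFrobenioid_istr hF)
  let X₁ : Birat (istrFunctor F) (isFrobenioid_istr hF) hsq' :=
    Birat.of (istrFunctor F) (isFrobenioid_istr hF) hsq' (Istr.mk X.out (hiso X.out))
  have h₁ : (ofFunctor (zeroMonoid D) (toElemZero (isFrobenioid_istr hF) hsq')).IsFrobeniusCompact X₁ :=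
    isFrobeniusCompact_istrBirat_of_ofIstr hF hsq hsq' X₁ hX
  exact ⟨(toUntrBirat hF hsq').obj X₁, isFrobeniusCompact_toUntrBirat_obj hF hsq' hut X₁ h₁⟩

end Birat

end PreFrobenioid

end Literature.AlgebraicGeometry.Frobenioids
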